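import Literature.AlgebraicGeometry.Crystalline.DeRhamComplexSheaf
import Literature.AlgebraicGeometry.Motives.BaseBasicOpenOver
import Mathlib.Algebra.Category.ModuleCat.Differentials.Presheaf
import HarnessLib

/-!
# Base change of the de Rham complex along a localization of the base: `Ω•_{X/A} ≅ Ω•_{X/M⁻¹A}`

Stacks Tag 00RT (Lemma 10.131.8, first assertion): *if `S ⊆ A` is a multiplicative subset mapping
to invertible elements of `B`, then `Ω_{B/A} = Ω_{B/S⁻¹A}`*. We prove the version for presheaves
of rings and propagate it through exterior powers, the exterior derivative and sheafification:

* `IsLocalizationLike ψ` — the (bodied) hypothesis on `ψ : S ⟶ S'` that `S'` is pointwise a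
  localization of `S`; `isLocalizationLike_const_algebraMap` — it holds for the constant morphism
  `A → M⁻¹A`;
* `d_app_eq_zero_of_isLocalizationLike` — the key computation: a `(ψ ≫ φ')`-derivation kills
  `φ'(S')`;
* `relativeDifferentialsCompIso` — `Ω_{ψ ≫ φ'} ≅ Ω_{φ'}` as presheaves of modules, from Mathlib's
  universal property of `PresheafOfModules.DifferentialsConstruction.relativeDifferentials'`;
* `exteriorPowerPresheafMap`, `exteriorPowerPresheafMapIso` — functoriality of the tree's
  `Motives.exteriorPowerPresheaf` in the presheaf of modules;
* `formsPresheafCompIso`, `formsPresheafCompIso_hom_dApp`, `deRhamComplexPresheafCompIso`,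
  `deRhamComplexSheafCompIso` — `Ω•_{ψ ≫ φ'} ≅ Ω•_{φ'}` as complexes of presheaves / sheaves;
* `baseBasicOpenAlgebraicDeRhamComplexIso` — for an `A`-scheme `𝒳` and `r ∈ A`,
  `Ω•_{D(r)/A} ≅ Ω•_{D(r)/A[1/r]}` on the open subscheme `D(r) = 𝒳[1/r]`.

## Why

For a smooth proper `𝒳 / W(k)` the generic fibre is `𝒳[1/p]` (`Motives/WittSchemeGenericFibre`),
a `K = W(k)[1/p]`-scheme (`Motives/BaseBasicOpenOver`); together with
`Crystalline/DeRhamComplexRestriction` (`Ω•_{𝒳/W}|_U ≅ Ω•_{U/W}`) this file identifies the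
restriction of `Ω•_{𝒳/W}` to the generic fibre with `Ω•_{𝒳[1/p]/K}`, the complex to which
Deligne's degeneration theorem over the characteristic-zero field `K` applies.

## References

* The Stacks project, Tag 00RT (Algebra, Lemma 10.131.8). [StacksProject]
* A. Grothendieck, J. Dieudonné, EGA IV₄ (Publ. Math. IHÉS 32, 1967), 16.4–16.6 (functoriality of
  `Ω•`). [folklore]

Everything is proved; no named facts.
-/

noncomputable section

open CategoryTheory Opposite TopologicalSpace

universe v₁ u₁ u

namespace Literature.AlgebraicGeometry.Crystalline

namespace DeRhamComplexBaseChange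


open PresheafOfModules PresheafOfModules.DifferentialsConstruction

variable {D : Type u₁} [Category.{v₁} D] {S S' R : Dᵒᵖ ⥤ CommRingCat.{u}} (ψ : S ⟶ S') (φ' : S' ⟶ R)

/-- A `φ'`-derivation is a `(ψ ≫ φ')`-derivation (restriction of linearity along `ψ`).
[folklore] -/
def Derivation'.ofComp {M : PresheafOfModules.{u} (R ⋙ forget₂ _ _)} (d : M.Derivation' φ') :
    M.Derivation' (ψ ≫ φ') where
  d := d.d
  d_mul := d.d_mul
  d_map := d.d_map
  d_app a := by
    change d.d (φ'.app _ (ψ.app _ a)) = 0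
    exact d.d_app _

/-- `Derivation'.ofComp` has the same underlying `d`. [folklore] -/
@[simp]
theorem Derivation'.ofComp_d {M : PresheafOfModules.{u} (R ⋙ forget₂ _ _)} (d : M.Derivation' φ')
    {X : Dᵒᵖ} (b : R.obj X) : (Derivation'.ofComp ψ φ' d).d b = d.d b := rfl

/-- The hypothesis "`S'` is pointwise a localization of `S` along `ψ`": every `x ∈ S'(U)`
satisfies `x · ψ(s) = ψ(a)` for some `a, s ∈ S(U)` with `ψ(s)` invertible (e.g. `S' = M⁻¹S`
pointwise, `isLocalizationLike_const_algebraMap`). This is a hypothesis-carrying predicate with a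
body, not a named fact. [folklore] -/
structure IsLocalizationLike : Prop where
  /-- every `x ∈ S'(U)` is a fraction `ψ(a)/ψ(s)` with `ψ(s)` invertible -/
  exists_of (X : Dᵒᵖ) (x : S'.obj X) :
    ∃ a s : S.obj X, IsUnit (ψ.app X s) ∧ x * ψ.app X s = ψ.app X a

variable {ψ φ'}

/-- Under `IsLocalizationLike ψ`, a `(ψ ≫ φ')`-derivation kills `φ'(S')`: if `x ψ(s) = ψ(a)` with
`ψ(s)` invertible then `φ'(ψ s) · d(φ' x) = d(φ'(ψ a)) - φ' x · d(φ'(ψ s)) = 0`, and `φ'(ψ s)` is a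
unit (Stacks 00RT, first assertion, the key computation). [cite: StacksProject, Tag 00RT] -/
theorem d_app_eq_zero_of_isLocalizationLike (hψ : IsLocalizationLike ψ)
    {M : PresheafOfModules.{u} (R ⋙ forget₂ _ _)} (d : M.Derivation' (ψ ≫ φ')) {X : Dᵒᵖ}
    (x : S'.obj X) : d.d (φ'.app X x) = 0 := by
  obtain ⟨a, s, hs, hx⟩ := hψ.exists_of X x
  have hu : IsUnit (φ'.app X (ψ.app X s)) := hs.map _
  have h0 : d.d (φ'.app X (ψ.app X s)) = 0 := d.d_app (X := X) s
  have h1 : d.d (φ'.app X x * φ'.app X (ψ.app X s)) = 0 := by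
    rw [← map_mul, hx]
    exact d.d_app (X := X) a
  rw [d.d_mul, h0, smul_zero, zero_add] at h1
  -- h1 : φ'(ψ s) • d (φ' x) = 0 with φ'(ψ s) a unit
  obtain ⟨u, hu'⟩ := hu
  have := congrArg (fun m => ((u⁻¹ : (R.obj X)ˣ) : R.obj X) • m) h1
  simpa only [← hu', smul_smul, Units.inv_mul, one_smul, smul_zero] using this

/-- Under `IsLocalizationLike ψ`, a `(ψ ≫ φ')`-derivation as a `φ'`-derivation. [folklore] -/
def Derivation'.toOfIsLocalizationLike (hψ : IsLocalizationLike ψ)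
    {M : PresheafOfModules.{u} (R ⋙ forget₂ _ _)} (d : M.Derivation' (ψ ≫ φ')) :
    M.Derivation' φ' where
  d := d.d
  d_mul := d.d_mul
  d_map := d.d_map
  d_app x := d_app_eq_zero_of_isLocalizationLike hψ d x

variable (ψ φ')

/-- **`Ω_{ψ ≫ φ'} ≅ Ω_{φ'}`** (Stacks 00RT: "if `S ⊆ A` maps to invertible elements of `B` then
`Ω_{B/A} = Ω_{B/S⁻¹A}`", for presheaves of rings): when `S'` is pointwise a localization of `S`,
the presheaves of relative differentials of `ψ ≫ φ'` and of `φ'` are isomorphic as presheaves of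
`R`-modules — both satisfy the universal property (Mathlib's
`PresheafOfModules.DifferentialsConstruction.isUniversal'`) for `(ψ ≫ φ')`-derivations.
[cite: StacksProject, Tag 00RT] -/
def relativeDifferentialsCompIso (hψ : IsLocalizationLike ψ) :
    relativeDifferentials' (ψ ≫ φ') ≅ relativeDifferentials' φ' where
  hom := (isUniversal' (ψ ≫ φ')).desc (Derivation'.ofComp ψ φ' (derivation' φ'))
  inv := (isUniversal' φ').desc (Derivation'.toOfIsLocalizationLike hψ (derivation' (ψ ≫ φ')))
  hom_inv_id := by
    apply (isUniversal' (ψ ≫ φ')).postcomp_injective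
    ext X b
    have h1 := Derivation.congr_d ((isUniversal' (ψ ≫ φ')).fac
      (Derivation'.ofComp ψ φ' (derivation' φ'))) b
    have h2 := Derivation.congr_d ((isUniversal' φ').fac
      (Derivation'.toOfIsLocalizationLike hψ (derivation' (ψ ≫ φ')))) b
    rw [Derivation.postcomp_d_apply] at h1 h2 ⊢
    rw [Derivation.postcomp_d_apply, PresheafOfModules.comp_app]
    erw [ModuleCat.comp_apply, h1]
    erw [h2]
    rfl
  inv_hom_id := by
    apply (isUniversal' φ').postcomp_injective
    ext X b
    have h1 := Derivation.congr_d ((isUniversal' (ψ ≫ φ')).fac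
      (Derivation'.ofComp ψ φ' (derivation' φ'))) b
    have h2 := Derivation.congr_d ((isUniversal' φ').fac
      (Derivation'.toOfIsLocalizationLike hψ (derivation' (ψ ≫ φ')))) b
    rw [Derivation.postcomp_d_apply] at h1 h2 ⊢
    rw [Derivation.postcomp_d_apply, PresheafOfModules.comp_app]
    erw [ModuleCat.comp_apply, h2]
    erw [h1]
    rfl

/-! ### Functoriality of exterior powers of presheaves of modules -/

section ExteriorPower

open Literature.AlgebraicGeometry.Motives

variable {C : Type u₁} [Category.{v₁} C] {T : Cᵒᵖ ⥤ CommRingCat.{u}}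
  {P Q : PresheafOfModules.{u} (T ⋙ forget₂ _ _)}

/-- **Functoriality of `⋀ⁿ` in the presheaf of modules** (complementing the tree's
`Motives.exteriorPowerPresheaf`, which is only given on objects): a morphism `u : P ⟶ Q` induces
`⋀ⁿ P ⟶ ⋀ⁿ Q`, objectwise Mathlib's `ModuleCat.exteriorPower.map`. [folklore] -/
def exteriorPowerPresheafMap (u : P ⟶ Q) (n : ℕ) :
    exteriorPowerPresheaf P n ⟶ exteriorPowerPresheaf Q n where
  app X := ModuleCat.exteriorPower.map (u.app X) n
  naturality {X Y} f := by
    apply ModuleCat.exteriorPower.hom_ext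
    ext m
    simp only [ModuleCat.AlternatingMap.postcomp_apply]
    change (ModuleCat.exteriorPower.map (u.app Y) n) ((exteriorPowerPresheaf P n).map f
        (ModuleCat.exteriorPower.mk m)) =
      (exteriorPowerPresheaf Q n).map f ((ModuleCat.exteriorPower.map (u.app X) n)
        (ModuleCat.exteriorPower.mk m))
    rw [exteriorPowerPresheaf_map_mk, ModuleCat.exteriorPower.map_mk,
      ModuleCat.exteriorPower.map_mk, exteriorPowerPresheaf_map_mk]
    congr 1
    funext i
    exact PresheafOfModules.naturality_apply u f (m i)

/-- `⋀ⁿ u` on pure wedges. [folklore] -/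
@[simp]
theorem exteriorPowerPresheafMap_app_mk (u : P ⟶ Q) {n : ℕ} (X : Cᵒᵖ) (m : Fin n → P.obj X) :
    (exteriorPowerPresheafMap u n).app X (ModuleCat.exteriorPower.mk m) =
      ModuleCat.exteriorPower.mk (fun i => u.app X (m i)) :=
  ModuleCat.exteriorPower.map_mk _ _

/-- `⋀ⁿ (𝟙 P) = 𝟙`. [folklore] -/
theorem exteriorPowerPresheafMap_id (n : ℕ) :
    exteriorPowerPresheafMap (𝟙 P) n = 𝟙 _ := by
  ext X : 1
  apply ModuleCat.exteriorPower.hom_ext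
  ext m
  simp only [ModuleCat.AlternatingMap.postcomp_apply]
  erw [exteriorPowerPresheafMap_app_mk]
  rfl

/-- `⋀ⁿ (u ≫ u') = ⋀ⁿ u ≫ ⋀ⁿ u'`. [folklore] -/
theorem exteriorPowerPresheafMap_comp {P' : PresheafOfModules.{u} (T ⋙ forget₂ _ _)} (u : P ⟶ Q)
    (u' : Q ⟶ P') (n : ℕ) :
    exteriorPowerPresheafMap (u ≫ u') n =
      exteriorPowerPresheafMap u n ≫ exteriorPowerPresheafMap u' n := by
  ext X : 1
  apply ModuleCat.exteriorPower.hom_ext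
  ext m
  simp only [ModuleCat.AlternatingMap.postcomp_apply]
  erw [exteriorPowerPresheafMap_app_mk]
  change _ = (exteriorPowerPresheafMap u' n).app X ((exteriorPowerPresheafMap u n).app X
    (ModuleCat.exteriorPower.mk m))
  erw [exteriorPowerPresheafMap_app_mk, exteriorPowerPresheafMap_app_mk]
  rfl

/-- `⋀ⁿ` of an isomorphism of presheaves of modules. [folklore] -/
def exteriorPowerPresheafMapIso (e : P ≅ Q) (n : ℕ) :
    exteriorPowerPresheaf P n ≅ exteriorPowerPresheaf Q n where
  hom := exteriorPowerPresheafMap e.hom n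
  inv := exteriorPowerPresheafMap e.inv n
  hom_inv_id := by rw [← exteriorPowerPresheafMap_comp, e.hom_inv_id, exteriorPowerPresheafMap_id]
  inv_hom_id := by rw [← exteriorPowerPresheafMap_comp, e.inv_hom_id, exteriorPowerPresheafMap_id]

end ExteriorPower

/-! ### The de Rham complexes of `ψ ≫ φ'` and `φ'` -/

section Forms

open Literature.AlgebraicGeometry.Motives Literature.AlgebraicGeometry.Crystalline
  Literature.AlgebraicGeometry.Crystalline.DeRhamComplexPresheaf
  Literature.AlgebraicGeometry.Crystalline.KaehlerExteriorDerivative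

variable (hψ : IsLocalizationLike ψ)

/-- On generators: the base change map sends `d b ↦ d b`. [folklore] -/
theorem relativeDifferentialsCompIso_hom_app_d (X : Dᵒᵖ) (b : R.obj X) :
    (relativeDifferentialsCompIso ψ φ' hψ).hom.app X ((derivation' (ψ ≫ φ')).d b) =
      (derivation' φ').d b := by
  have h1 := Derivation.congr_d ((isUniversal' (ψ ≫ φ')).fac
    (Derivation'.ofComp ψ φ' (derivation' φ'))) b
  rwa [Derivation.postcomp_d_apply] at h1

/-- The base change map on `Ω¹` is Mathlib's `KaehlerDifferential.map` for the tower
`S(X) → S'(X) → R(X)`, elementwise. [folklore] -/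
theorem relativeDifferentialsCompIso_hom_app_apply (X : Dᵒᵖ)
    (ω : (relativeDifferentials' (ψ ≫ φ')).obj X) :
    letI := ((ψ ≫ φ').app X).hom.toAlgebra
    letI := (φ'.app X).hom.toAlgebra
    letI := (ψ.app X).hom.toAlgebra
    haveI : IsScalarTower (S.obj X) (S'.obj X) (R.obj X) := IsScalarTower.of_algebraMap_eq' rfl
    (relativeDifferentialsCompIso ψ φ' hψ).hom.app X ω =
      KaehlerDifferential.map (S.obj X) (S'.obj X) (R.obj X) (R.obj X) ω := by
  letI := ((ψ ≫ φ').app X).hom.toAlgebra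
  letI := (φ'.app X).hom.toAlgebra
  letI := (ψ.app X).hom.toAlgebra
  haveI : IsScalarTower (S.obj X) (S'.obj X) (R.obj X) := IsScalarTower.of_algebraMap_eq' rfl
  have hω : ω ∈ Submodule.span (R.obj X)
      (Set.range (KaehlerDifferential.D (S.obj X) (R.obj X))) := by
    rw [KaehlerDifferential.span_range_derivation]; trivial
  induction hω using Submodule.span_induction with
  | mem x hx =>
    obtain ⟨b, rfl⟩ := hx
    rw [KaehlerDifferential.map_D]
    exact relativeDifferentialsCompIso_hom_app_d ψ φ' hψ X b
  | zero => rw [map_zero]; exact (map_zero (KaehlerDifferential.map _ _ _ _)).symm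
  | add x y _ _ hx hy =>
    rw [map_add, hx, hy]; exact (map_add (KaehlerDifferential.map _ _ _ _) x y).symm
  | smul b x _ hx => rw [map_smul, hx]; exact (map_smul (KaehlerDifferential.map _ _ _ _) b x).symm

/-- **`Ωⁿ_{ψ ≫ φ'} ≅ Ωⁿ_{φ'}`** as presheaves of abelian groups (`⋀ⁿ` of the base change
isomorphism on `Ω¹`). [folklore] -/
def formsPresheafCompIso (n : ℕ) : formsPresheaf (ψ ≫ φ') n ≅ formsPresheaf φ' n :=
  (PresheafOfModules.toPresheaf _).mapIso
    (exteriorPowerPresheafMapIso (relativeDifferentialsCompIso ψ φ' hψ) n)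

/-- The components of `formsPresheafCompIso` are `⋀ⁿ` of the `Ω¹` isomorphism. [folklore] -/
theorem formsPresheafCompIso_hom_app_apply (n : ℕ) (X : Dᵒᵖ)
    (x : (formsPresheaf (ψ ≫ φ') n).obj X) :
    (formsPresheafCompIso ψ φ' hψ n).hom.app X x =
      exteriorPower.map n ((relativeDifferentialsCompIso ψ φ' hψ).hom.app X).hom x :=
  rfl

/-- The base change isomorphisms commute with the exterior derivatives (the uniqueness principle
`KaehlerExteriorDerivative.naturality_of_ιMulti` of the tree: an additive, semilinear map given on
pure wedges by `KaehlerDifferential.map` commutes with `d`). [folklore] -/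
theorem formsPresheafCompIso_hom_dApp (n : ℕ) (X : Dᵒᵖ) (x : (formsPresheaf (ψ ≫ φ') n).obj X) :
    (formsPresheafCompIso ψ φ' hψ (n + 1)).hom.app X (dApp (ψ ≫ φ') X n x) =
      dApp φ' X n ((formsPresheafCompIso ψ φ' hψ n).hom.app X x) := by
  letI iA : Algebra (S.obj X) (R.obj X) := ((ψ ≫ φ').app X).hom.toAlgebra
  letI iA' : Algebra (S'.obj X) (R.obj X) := (φ'.app X).hom.toAlgebra
  letI iAA' : Algebra (S.obj X) (S'.obj X) := (ψ.app X).hom.toAlgebra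
  haveI iT : IsScalarTower (S.obj X) (S'.obj X) (R.obj X) := IsScalarTower.of_algebraMap_eq' rfl
  let G : ⋀[R.obj X]^n (Ω[R.obj X⁄S.obj X]) →+ ⋀[R.obj X]^n (Ω[R.obj X⁄S'.obj X]) :=
    ((formsPresheafCompIso ψ φ' hψ n).hom.app X).hom
  let G' : ⋀[R.obj X]^(n + 1) (Ω[R.obj X⁄S.obj X]) →+ ⋀[R.obj X]^(n + 1) (Ω[R.obj X⁄S'.obj X]) :=
    ((formsPresheafCompIso ψ φ' hψ (n + 1)).hom.app X).hom
  refine @Literature.AlgebraicGeometry.Crystalline.KaehlerExteriorDerivative.naturality_of_ιMulti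
    (S.obj X) (S'.obj X) (R.obj X) (R.obj X) _ _ _ _ iA iA' iAA' iA inferInstance iT inferInstance
    n G G' ?_ ?_ ?_ ?_ x
  · intro b y
    exact (exteriorPower.map n ((relativeDifferentialsCompIso ψ φ' hψ).hom.app X).hom).map_smul b y
  · intro v
    change exteriorPower.map n ((relativeDifferentialsCompIso ψ φ' hψ).hom.app X).hom
      (exteriorPower.ιMulti _ n v) = _
    rw [exteriorPower.map_apply_ιMulti]
    exact congrArg _ (funext fun i => relativeDifferentialsCompIso_hom_app_apply ψ φ' hψ X (v i))
  · intro b y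
    exact (exteriorPower.map (n + 1)
      ((relativeDifferentialsCompIso ψ φ' hψ).hom.app X).hom).map_smul b y
  · intro v
    change exteriorPower.map (n + 1) ((relativeDifferentialsCompIso ψ φ' hψ).hom.app X).hom
      (exteriorPower.ιMulti _ (n + 1) v) = _
    rw [exteriorPower.map_apply_ιMulti]
    exact congrArg _ (funext fun i => relativeDifferentialsCompIso_hom_app_apply ψ φ' hψ X (v i))

/-- **The presheaf de Rham complexes of `ψ ≫ φ'` and of `φ'` are isomorphic** when `S'` is
pointwise a localization of `S` (EGA IV₄ 16.6 with Stacks 00RT termwise).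
[cite: StacksProject, Tag 00RT] -/
def deRhamComplexPresheafCompIso : deRhamComplexPresheaf (ψ ≫ φ') ≅ deRhamComplexPresheaf φ' :=
  HomologicalComplex.Hom.isoOfComponents (fun n => formsPresheafCompIso ψ φ' hψ n)
    (fun i j hij => by
      obtain rfl : i + 1 = j := hij
      rw [deRhamComplexPresheaf_d, deRhamComplexPresheaf_d]
      ext X : 2
      apply AddCommGrpCat.hom_ext
      refine AddMonoidHom.ext fun x => ?_
      exact (formsPresheafCompIso_hom_dApp ψ φ' hψ i X x).symm)

end Forms

/-! ### Sheaf level and schemes -/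

section SheafLevel

open Literature.AlgebraicGeometry.Crystalline

variable (J : GrothendieckTopology D) [HasSheafify J AddCommGrpCat.{u}] (hψ : IsLocalizationLike ψ)

/-- **`Ω•_{ψ ≫ φ'} ≅ Ω•_{φ'}` as complexes of abelian sheaves** (sheafify
`deRhamComplexPresheafCompIso`). [folklore] -/
def deRhamComplexSheafCompIso : deRhamComplexSheaf J (ψ ≫ φ') ≅ deRhamComplexSheaf J φ' :=
  ((presheafToSheaf J AddCommGrpCat.{u}).mapHomologicalComplex _).mapIso
    (deRhamComplexPresheafCompIso ψ φ' hψ)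

/-- The same for any `φ` known to factor as `ψ ≫ φ'`. [folklore] -/
def deRhamComplexSheafIsoOfEqComp (φ : S ⟶ R) (h : φ = ψ ≫ φ') :
    deRhamComplexSheaf J φ ≅ deRhamComplexSheaf J φ' :=
  eqToIso (by subst h; rfl) ≪≫ deRhamComplexSheafCompIso ψ φ' J hψ

end SheafLevel

section Const

variable {A B : Type u} [CommRing A] [CommRing B] [Algebra A B]

/-- The constant morphism of presheaves of rings `A → M⁻¹A` is pointwise a localization.
[folklore] -/
theorem isLocalizationLike_const_algebraMap (M : Submonoid A) [IsLocalization M B] :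
    IsLocalizationLike ((Functor.const Dᵒᵖ).map (CommRingCat.ofHom (algebraMap A B))) :=
  ⟨fun _ x => by
    obtain ⟨⟨a, s⟩, h⟩ := IsLocalization.surj M (show B from x)
    exact ⟨a, s.1, IsLocalization.map_units B s, h⟩⟩

end Const

end DeRhamComplexBaseChange

section SchemeLevel

open _root_.AlgebraicGeometry Literature.AlgebraicGeometry.Motives DeRhamComplexBaseChange

variable {A B : Type u} [CommRing A] [CommRing B] [Algebra A B] (r : A) [IsLocalization.Away r B]
  (𝒳 : Over (Spec (CommRingCat.of A)))

/-- **`Ω•_{D(r)/A} ≅ Ω•_{D(r)/A[1/r]}`**: on the open subscheme `D(r) ⊆ 𝒳` of an `A`-scheme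
(`Motives.baseBasicOpen`, where `r` is invertible; an `A[1/r]`-scheme by
`Motives.baseBasicOpenOver`), the algebraic de Rham complex relative to `A` is the algebraic
de Rham complex relative to `A[1/r]`. With `A = W(k)`, `r = p` this identifies `Ω•_{𝒳[1/p]/W}`
with `Ω•_{𝒳[1/p]/K}`, `K = W(k)[1/p]`. [cite: StacksProject, Tag 00RT] -/
def baseBasicOpenAlgebraicDeRhamComplexIso :
    algebraicDeRhamComplex (Over.mk ((baseBasicOpen r 𝒳).ι ≫ 𝒳.hom)) ≅
      algebraicDeRhamComplex (baseBasicOpenOver r 𝒳 (S := B)) :=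
  deRhamComplexSheafIsoOfEqComp
    (ψ := (Functor.const _).map (CommRingCat.ofHom (algebraMap A B)))
    (φ' := constToPresheaf (baseBasicOpenOver r 𝒳 (S := B)))
    (Opens.grothendieckTopology (baseBasicOpenOver r 𝒳 (S := B)).left)
    (isLocalizationLike_const_algebraMap (B := B) (Submonoid.powers r))
    (constToPresheaf (Over.mk ((baseBasicOpen r 𝒳).ι ≫ 𝒳.hom)))
    (constToPresheaf_baseBasicOpen r 𝒳)

end SchemeLevel


end Literature.AlgebraicGeometry.Crystalline
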